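import Literature.AlgebraicGeometry.Motives.AbelianVarietySimpleFactorsUnique
import Literature.AlgebraicGeometry.Motives.AbelianVarietyIsogenousProductOfSimples
import Literature.AlgebraicGeometry.Motives.AbelianVarietyPoincarePerfectField
import HarnessLib

/-!
# An abelian variety whose endomorphism algebra has no zero divisors is simple (perfect base field)

D. Mumford, *Abelian Varieties* (1970), §19, Corollary 2 of Theorem 1 and «The structure of
`End⁰(X)`» (pp. 173–174): `X` is isogenous to `∏ X_i^{n_i}` with the `X_i` simple and pairwise
non-isogenous, and `End⁰(X) = ⊕ M_{n_i}(D_i)` with `D_i = End⁰(X_i)` division algebras; in particular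
**`End⁰(X)` is a division algebra if and only if `X` is simple**.  G. Shimura, *Abelian Varieties with
Complex Multiplication and Modular Functions* (1998), §5.1 p. 40: «`End_Q(B)` is a division algebra,
since `B` is simple»; §1.4.  The tree has the direction «simple ⇒ division algebra»
(`ComplexMultiplication.endAlgebra_exists_inv_of_isSimple`, `Milne1999.CMTypeOfSimpleSubvariety`) and
uses «`End⁰(B)` a field» as the shape of the simple CM factors (`Milne1999.IsOfCMTypeSimple`), but not
the converse.  This file PROVES the converse over a PERFECT field `K` (v2; v1 assumed `K` algebraically closed —
every statement is otherwise unchanged, and `[IsAlgClosed K]` instances still apply through Mathlib's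
`IsAlgClosed.perfectField`), on the tree's carriers `AbelianVariety K`, `End⁰(A) = A.endAlgebra = ℚ ⊗_ℤ End A`:

* `exists_ne_zero_mul_eq_zero_of_not_isSimple` — if `A` is NOT simple, `End⁰(A)` has zero divisors:
  an abelian subvariety `i : Y ↪ A` with `0 < dim Y < dim A` (definition of `IsSimple`) has a Poincaré
  complement `j : Z ↪ A`, `(i, j) : Y ⊞ Z → A` an isogeny (tree theorem
  `poincare_complete_reducibility_of_perfectField`, Milne 1986 Prop. 12.1 over a perfect field; Mumford §19
  Thm. 1 over `K̄`) with quasi-inverse `τ`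
  (`IsIsogeny.exists_nsmul_inverse_holds`); then `e₁ = τ ≫ pr₁ ≫ i` and `e₂ = τ ≫ pr₂ ≫ j` are
  non-zero endomorphisms of `A` with `e₂ ≫ e₁ = 0`, i.e. `(1 ⊗ e₁)(1 ⊗ e₂) = 0` in `End⁰(A)`;
* `isSimple_of_forall_mul_eq_zero` — **if `End⁰(A)` has no zero divisors then `A` is simple**;
  `isSimple_of_isField_endAlgebra` — in particular if `End⁰(A)` is a field (the CM shape
  `IsOfCMTypeSimple`), `A` is simple; `isSimple_of_forall_exists_mul_eq_one` — if every non-zero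
  element of `End⁰(A)` is invertible, `A` is simple (converse of `endAlgebra_exists_inv_of_isSimple`).

Theorems only; no definition, no named fact (D-0026).

## References
* [Milne1986AbelianVarieties] J. S. Milne, *Abelian Varieties*, in Cornell–Silverman, *Arithmetic Geometry* (1986),
  §12 Prop. 12.1 (Poincaré's complete reducibility over an arbitrary perfect field) and p. 122 (PDF p. 189).
* [MumfordAV1970] D. Mumford, *Abelian Varieties* (1970), §19 Thm. 1, Cor. 1–2 and pp. 173–174; not
  held, cited through Milne 1986 §12 (held `book:cornellnd-arithmetic-geometry`, PDF p. 189: «Each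
  `End⁰(A_i)` is a skew field … `End⁰(A) = ∏ End⁰(A_i^{r_i})`»).
* [Shimura1998] G. Shimura, *Abelian Varieties with Complex Multiplication and Modular Functions*
  (1998), §5.1 Prop. 4 proof, p. 40 (held chunk p0049 L1).

## Design
Mathlib used: `biprod.inl_desc`, `biprod.inr_desc`, `biprod.inl_fst`, `biprod.inr_fst`,
`biprod.inl_snd`, `biprod.inr_snd`.  `End A = (A ⟶ A)` with `f * g = g ≫ f`; elements of `End⁰(A)`
through `endAlgebra.of` (injective: `endAlgebra.of_injective_of_isIsogeny_zsmul_id`).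
-/

noncomputable section

universe u

open CategoryTheory CategoryTheory.Limits

namespace Literature.AlgebraicGeometry.Motives

namespace AbelianVariety

variable {K : Type u} [Field K] [PerfectField K] {A : AbelianVariety K}

/-- **A non-simple abelian variety has zero divisors in `End⁰`.** If `A` (over a perfect field) is not
simple, there are non-zero `x, y ∈ End⁰(A)` with `x y = 0`: for an abelian subvariety
`i : Y ↪ A`, `0 < dim Y < dim A`, with Poincaré complement `j : Z ↪ A` and a quasi-inverse `τ` of the
isogeny `(i, j) : Y ⊞ Z → A` (`(i, j) τ = n`, `τ (i, j) = n`), the endomorphisms `e₁ = τ pr₁ i`,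
`e₂ = τ pr₂ j` satisfy `e₂ ≫ e₁ = 0` while `i τ pr₁ = n · 𝟙_Y` and `j τ pr₂ = n · 𝟙_Z` force
`e₁, e₂ ≠ 0`. [cite: MumfordAV1970, §19 Thm. 1 and Cor. 2 (pp. 173–174)]
[cite: Milne1986AbelianVarieties, §12 Prop. 12.1 and p. 122 (PDF p. 189)] -/
theorem exists_ne_zero_mul_eq_zero_of_not_isSimple (hA : ¬ IsSimple A) :
    ∃ x y : A.endAlgebra, x ≠ 0 ∧ y ≠ 0 ∧ x * y = 0 := by
  obtain ⟨Y, i, hi, hY0, hYA⟩ := exists_abelianSubvariety_of_not_isSimple hA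
  haveI := hi
  obtain ⟨Z, j, -, hσ⟩ := poincare_complete_reducibility_of_perfectField i
  obtain ⟨τ, n, hn, hστ, hτσ⟩ := IsIsogeny.exists_nsmul_inverse_holds hσ
  have hdim : Y.dim + Z.dim = A.dim := by
    rw [← dim_biprod]
    exact dim_eq_of_isIsogeny hσ
  have hZ0 : 0 < Z.dim := by omega
  -- the retractions up to `n`
  have hri : i ≫ τ ≫ biprod.fst = n • 𝟙 Y := by
    rw [← biprod.inl_desc i j, Category.assoc, reassoc_of% hστ, Preadditive.nsmul_comp,
      Category.id_comp, Preadditive.comp_nsmul, biprod.inl_fst]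
  have hrj : j ≫ τ ≫ biprod.snd = n • 𝟙 Z := by
    rw [← biprod.inr_desc i j, Category.assoc, reassoc_of% hστ, Preadditive.nsmul_comp,
      Category.id_comp, Preadditive.comp_nsmul, biprod.inr_snd]
  -- the two endomorphisms
  set e₁ : A ⟶ A := τ ≫ biprod.fst ≫ i with he₁
  set e₂ : A ⟶ A := τ ≫ biprod.snd ≫ j with he₂
  have h21 : e₂ ≫ e₁ = 0 := by
    rw [he₁, he₂, ← biprod.inr_desc i j]
    simp only [Category.assoc]
    rw [reassoc_of% hστ, Preadditive.nsmul_comp, Category.id_comp, Preadditive.comp_nsmul,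
      Preadditive.comp_nsmul, biprod.inr_fst_assoc, Limits.zero_comp, Limits.comp_zero, smul_zero,
      Limits.comp_zero]
  have hne₁ : e₁ ≠ 0 := by
    intro h0
    have hsq : (i ≫ τ ≫ biprod.fst) ≫ (i ≫ τ ≫ biprod.fst) = (n * n) • 𝟙 Y := by
      rw [hri, Preadditive.nsmul_comp, Preadditive.comp_nsmul, Category.id_comp, ← mul_nsmul']
    have hzero : (i ≫ τ ≫ biprod.fst) ≫ (i ≫ τ ≫ biprod.fst) = 0 := by
      rw [show (i ≫ τ ≫ biprod.fst) ≫ (i ≫ τ ≫ biprod.fst) = i ≫ e₁ ≫ τ ≫ biprod.fst by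
        rw [he₁]; simp only [Category.assoc], h0, Limits.zero_comp, Limits.comp_zero]
    rw [hzero] at hsq
    exact id_ne_zero_of_dim_pos hY0 (hom_eq_zero_of_nsmul_eq_zero (Nat.mul_pos hn hn).ne' hsq.symm)
  have hne₂ : e₂ ≠ 0 := by
    intro h0
    have hsq : (j ≫ τ ≫ biprod.snd) ≫ (j ≫ τ ≫ biprod.snd) = (n * n) • 𝟙 Z := by
      rw [hrj, Preadditive.nsmul_comp, Preadditive.comp_nsmul, Category.id_comp, ← mul_nsmul']
    have hzero : (j ≫ τ ≫ biprod.snd) ≫ (j ≫ τ ≫ biprod.snd) = 0 := by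
      rw [show (j ≫ τ ≫ biprod.snd) ≫ (j ≫ τ ≫ biprod.snd) = j ≫ e₂ ≫ τ ≫ biprod.snd by
        rw [he₂]; simp only [Category.assoc], h0, Limits.zero_comp, Limits.comp_zero]
    rw [hzero] at hsq
    exact id_ne_zero_of_dim_pos hZ0 (hom_eq_zero_of_nsmul_eq_zero (Nat.mul_pos hn hn).ne' hsq.symm)
  -- pass to `End⁰(A)`
  have inj := endAlgebra.of_injective_of_isIsogeny_zsmul_id (isIsogeny_zsmul_id_holds A)
  refine ⟨endAlgebra.of A (End.of e₁), endAlgebra.of A (End.of e₂), ?_, ?_, ?_⟩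
  · intro h
    exact hne₁ (inj (a₂ := 0) (by rw [map_zero]; exact h))
  · intro h
    exact hne₂ (inj (a₂ := 0) (by rw [map_zero]; exact h))
  · rw [← map_mul, show End.of e₁ * End.of e₂ = End.of (e₂ ≫ e₁) from rfl, h21]
    exact map_zero _

/-- **`End⁰(A)` without zero divisors ⟹ `A` simple** (over a perfect field; Mumford §19
Cor. 2: `End⁰` of a non-simple `A ∼ ∏ A_i^{n_i}` is `⊕ M_{n_i}(D_i)`, never a domain).
[cite: MumfordAV1970, §19 Cor. 2 of Thm. 1 (p. 174)] -/
theorem isSimple_of_forall_mul_eq_zero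
    (h : ∀ x y : A.endAlgebra, x * y = 0 → x = 0 ∨ y = 0) : IsSimple A := by
  by_contra hA
  obtain ⟨x, y, hx, hy, hxy⟩ := exists_ne_zero_mul_eq_zero_of_not_isSimple hA
  rcases h x y hxy with h0 | h0
  · exact hx h0
  · exact hy h0

/-- `End⁰(A)` a domain (`NoZeroDivisors`) ⟹ `A` simple. [cite: MumfordAV1970, §19 Cor. 2 of Thm. 1 (p. 174)] -/
theorem isSimple_of_noZeroDivisors_endAlgebra [NoZeroDivisors A.endAlgebra] : IsSimple A :=
  isSimple_of_forall_mul_eq_zero fun _ _ hxy => eq_zero_or_eq_zero_of_mul_eq_zero hxy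

/-- **`End⁰(A)` a division algebra ⟹ `A` simple**: if every non-zero element of `End⁰(A)` has a
right inverse, `A` is simple — the converse of the tree's `endAlgebra_exists_inv_of_isSimple`
(Shimura §5.1 p. 40: «`End_Q(B)` is a division algebra, since `B` is simple»).
[cite: MumfordAV1970, §19 Cor. 2 of Thm. 1 (p. 174)] [cite: Shimura1998, §5.1 Proposition 4 (proof)] -/
theorem isSimple_of_forall_exists_mul_eq_one
    (h : ∀ x : A.endAlgebra, x ≠ 0 → ∃ y : A.endAlgebra, x * y = 1) : IsSimple A := by
  refine isSimple_of_forall_mul_eq_zero fun x y hxy => ?_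
  by_cases hx : x = 0
  · exact Or.inl hx
  · right
    obtain ⟨x', hx'⟩ := h x hx
    -- the right inverse `x'` of `x` is also a left inverse (`x'` has a right inverse `x''`, and
    -- `x = x (x' x'') = (x x') x'' = x''`), so `y = x' x y = 0`
    have hx'ne : x' ≠ 0 := by
      intro h0
      rw [h0, mul_zero] at hx'
      exact hx (by rw [← mul_one x, ← hx', mul_zero])
    obtain ⟨x'', hx''⟩ := h x' hx'ne
    have hxx'' : x = x'' := by
      rw [← mul_one x, ← hx'', ← mul_assoc, hx', one_mul]
    have hleft : x' * x = 1 := by rw [hxx'', hx'']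
    calc y = (x' * x) * y := by rw [hleft, one_mul]
      _ = 0 := by rw [mul_assoc, hxy, mul_zero]

/-- **`End⁰(A)` a field ⟹ `A` simple** (the shape `IsField End⁰(B)` of the simple CM factors,
`Milne1999.IsOfCMTypeSimple`, forces simplicity). [cite: MumfordAV1970, §19 Cor. 2 of Thm. 1 (p. 174)] -/
theorem isSimple_of_isField_endAlgebra (hF : IsField A.endAlgebra) : IsSimple A :=
  isSimple_of_forall_exists_mul_eq_one fun _ hx => hF.mul_inv_cancel hx

end AbelianVariety

end Literature.AlgebraicGeometry.Motives

end
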